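/-
Copyright (c) 2026 the pub-hodgecm-mathlib formalisation cell (harness21).  Prover seat hodgecm-mathlib-K2E1-p14 (g2), Track B «K2-LIT» ENGINE E1, h413 =
`stmt-HodgeConjecture-24833`, route `HCCMUnconditional`, 5Res ROADCARD §3′ D4′c (SD) AT M1 (dealer K2E1-plan (g7) (273)(ii)): the strip bound `hB` of the rank-one scattering scalar
ON THE PINNED PACKAGE'S CLAUSES (one source) — ★ p860833 §1 fed by the per-point families of ★ p860657′ built on the clauses and by ★ B2 at `V := ℂ`.
-/
import Summits.HodgeConjecture.HodgeConjecture.Theorems.K2E1ChiScatteringStripBoundLevelCMTwo          -- ★ p860833 (K2E1-p15): `hB_of_perPoint_families_off_countable`; brings ★ p860705∕p860657′ (`exists_perPoint_truncatedFamily'`, `countable_bad`, `exists_good_ball`)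
import Summits.HodgeConjecture.HodgeConjecture.Theorems.K2E1ChiScatteringRealPolesM1CMTwoLetterFree     -- ★ p860743 (K2E1-p13): `chi_scattering_hs_of_scalarPackage_m1_cm_two` (`hreal` on the clauses)
import Summits.HodgeConjecture.HodgeConjecture.Theorems.K2E1ChiScatteringFunctionalEquationM1CMTwo    -- ★ p860766 (K2E1-p13): `chi_scattering_fe_m1_cm_two`
import Summits.HodgeConjecture.HodgeConjecture.Theorems.K2E1ChiMaassSelbergDecayLetterM1CMTwo         -- ★ p860725 (K2E1-p12): `hdec_maximalLevel_cm_two`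
import Summits.HodgeConjecture.HodgeConjecture.Theorems.K2E1ChiMaassSelbergPairingModelCMTwo           -- ★ B2 p860575 (K2E4-p14): `inner_truncatedFamily_eq_fourTerm_chi_model_cm_two`
import Summits.HodgeConjecture.HodgeConjecture.Theorems.K2E1TruncatedEisensteinBoundedCMTwo            -- ★ (K2E1-p09 lineage): `memLp_quotFun_truncation_eisensteinSeriesU_flatSectionU_cm_two`
import HarnessLib

/-!
# D4′c (SD) at M1 — `K2E1ChiScatteringStripBoundOfPackageM1CMTwo`: THE STRIP BOUND `‖s(z)‖ ≤ B` ON `{½ < Re z ≤ σ₀, |Im z| ≥ 1}` FOR THE RANK-ONE SCATTERING SCALAR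
# `s = qc default` OF A SELF-DUAL UNITARY `χ` AT THE MAXIMAL LEVEL, ON THE PINNED PACKAGE'S CLAUSES

Track B ∕ K2-LIT, crux h413 = `stmt-HodgeConjecture-24833`, route of record `HCCMUnconditional`; cell `hodgecm-mathlib`, squad K2, ENGINE E1.  THEOREMS ONLY (no `def`, no `instance`,
no `notation`, no named-fact hypothesis, no `sorry`; default heartbeats); lane `--supports stmt-HodgeConjecture-24833 --as helper` (count-neutral).

THE MATHEMATICS ([MoeglinWaldspurger1995, IV.2.3, IV.3.12 (a)]; [Arthur1980TraceFormulaII, §4]; [BernsteinLapid2019, Thm 2.3, §4]).  ONE SOURCE (dealer (273)(ii)): the bound is proved for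
THE continued scalar `qc default` and THE pole set `P` of the package every other (SD)-at-M1 letter is typed on (★ `chi_scattering_real_poles_m1_complete_cm_two` ∕ ★
`exists_linearIsometry_chiSection_selfDual_m1_cm_two_of_package`'s binder block), NOT for a re-obtained package.  §1 builds, on those clauses, the PER-POINT continued truncated
`L²`-families at every good point of the half-planes off ONE countable set `S ⊇ P` (the band datum `w_z = f_z^φ + f_{1−z}^{qc(z)φ}` of ★ `K2E1ChiEisensteinPerPointFamilyM1CMTwo`, typed on
the clauses, into ★ `exists_perPoint_truncatedFamily'`); §2 reads the χ-MAASS–SELBERG FOUR-TERM FORMULA at level `T = 1` for RAW tube points (★ B2 `inner_truncatedFamily_eq_fourTerm_chi_model_cm_two`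
with the `L²`-classes of the truncations ★ `memLp_quotFun_truncation_eisensteinSeriesU_flatSectionU_cm_two` and the model section `ψ(z) = qc(z)•[φ|_K]`) in the RANK-ONE model `V := ℂ`,
`v := 1`, `M(z) := qc(z)•id`, `m := ‖[φ|_K]‖²`; §3 the HEAD: ★ K2E1-p15's generic `hB_of_perPoint_families_off_countable` on §1 + §2, the continuity on the half-strip coming from the
(d)-realness of ★ `chi_scattering_hs_of_scalarPackage_m1_cm_two` (non-real points of the closed half-strip are analytic points).
* §1 `perPoint_families_of_package_m1_cm_two`.  * §2 `fourTerm_rankOne_of_package_m1_cm_two`.  * §3 HEAD **`hB_of_package_m1_cm_two`** — `∃ B, ∀ z, ½ < Re z → Re z ≤ σ₀ → 1 ≤ |Im z| →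
  ‖qc default z‖ ≤ B`, in ★ p861041's binder bytes (`σ₀ > 1`).
HONEST LABEL: HC_CM is proved only modulo the 7 printed citations (2 remaining named inputs: hLiu418 = `stmt-HodgeConjecture-24832`, h413 = `stmt-HodgeConjecture-24833`) until rung 0
closes; this file asserts no named fact, closes no socket; count-neutral; letters: the package clauses only (one `obtain` of ★ p860788).

## References
* [MoeglinWaldspurger1995] C. Mœglin, J.-L. Waldspurger, *Spectral decomposition and Eisenstein series* (1995), IV.2.3, IV.3.12 (a).
* [Arthur1980TraceFormulaII] J. Arthur, *A trace formula for reductive groups II*, Compositio Math. 40 (1980), §4.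
* [BernsteinLapid2019] J. Bernstein, E. Lapid, *On the meromorphic continuation of Eisenstein series*, J. AMS 37 (2024), Thm 2.3, §4.
-/

set_option autoImplicit false
set_option linter.dupNamespace false  -- the mandated namespace repeats the summit's segment (`HodgeConjecture.HodgeConjecture`)

noncomputable section

open MeasureTheory MeasureTheory.Measure Set NumberField IsDedekindDomain Filter Topology Metric Complex
open scoped Real NNReal ENNReal ComplexConjugate InnerProductSpace BigOperators
open Literature.MeasureTheory.Group Literature.NumberTheory
open Literature.NumberTheory.Automorphic Literature.NumberTheory.Automorphic.UnitaryGroup AdelicGroupData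
open Literature.NumberTheory.GaloisRepresentations
open Summit.HodgeConjecture.HodgeConjecture.Cruxes.H413.K2E1BorelEisensteinU
open Summit.HodgeConjecture.HodgeConjecture.Cruxes.H413.K2E1BLBorelSpacesU2Defs
open Summit.HodgeConjecture.HodgeConjecture.Cruxes.H413.K2E1BLBorelOperatorsU2Defs
open Summit.HodgeConjecture.HodgeConjecture.Cruxes.H413.K2E1CharacterEisensteinU2Defs
open Summit.HodgeConjecture.HodgeConjecture.Cruxes.H413.K2E1ChiSectionSpaceU2Defs
open Summit.HodgeConjecture.HodgeConjecture.Cruxes.H413.K2E1ChiEisensteinPerPointFamilyCMTwo (exists_perPoint_truncatedFamily' countable_bad exists_good_ball)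
open Summit.HodgeConjecture.HodgeConjecture.Cruxes.H413.K2E1ChiEisensteinConstantTermCMTwo (borelConstantTerm_chiEisenstein_cm_two)
open Summit.HodgeConjecture.HodgeConjecture.Cruxes.H413.K2E1SphericalHeckeEigenSectionU2 (continuous_borelHeight_cpow norm_borelHeight_cpow borelHeight_coe_pos)
open Summit.HodgeConjecture.HodgeConjecture.Cruxes.H413.K2E1SphericalEisensteinPoleExclusionCMThree (countable_of_codiscreteWithin)
open Summit.HodgeConjecture.HodgeConjecture.Cruxes.H413.K2E1ChiScatteringStripBoundLevelCMTwo (hB_of_perPoint_families_off_countable)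
open Summit.HodgeConjecture.HodgeConjecture.Cruxes.H413.K2E1ChiScatteringRealPolesM1CMTwoLetterFree (chi_scattering_hs_of_scalarPackage_m1_cm_two)
open Summit.HodgeConjecture.HodgeConjecture.Cruxes.H413.K2E1ChiScatteringRealPolesM1CMTwoFinal (ne_zero_of_coeFn_ae_eq)
open Summit.HodgeConjecture.HodgeConjecture.Cruxes.H413.K2E1ChiScatteringFunctionalEquationM1CMTwo (chi_scattering_fe_m1_cm_two)
open Summit.HodgeConjecture.HodgeConjecture.Cruxes.H413.K2E1ChiMaassSelbergDecayLetterM1CMTwo (hdec_maximalLevel_cm_two)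
open Summit.HodgeConjecture.HodgeConjecture.Cruxes.H413.K2E1ChiMaassSelbergPairingModelCMTwo (inner_truncatedFamily_eq_fourTerm_chi_model_cm_two)
open Summit.HodgeConjecture.HodgeConjecture.Cruxes.H413.K2E1TruncatedEisensteinBoundedCMTwo (memLp_quotFun_truncation_eisensteinSeriesU_flatSectionU_cm_two)
open Summit.HodgeConjecture.HodgeConjecture.Cruxes.H413.K2E1MaassSelbergSphericalBracketsCMThree (idelicBracket_pos)
open Summit.HodgeConjecture.HodgeConjecture.Cruxes.H413.K2E1ChiMaassSelbergContinuedModelsCMTwo (real_mul_inner_self)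

namespace Summit.HodgeConjecture.HodgeConjecture.Cruxes.H413.K2E1ChiScatteringStripBoundOfPackageM1CMTwo

variable (L : Type) [Field L] [NumberField L] [IsCMField L]
variable [MeasurableSpace (quasiSplit (↥(maximalRealSubfield L)) L (IsCMField.complexConj L) 2).Adelic] [BorelSpace (quasiSplit (↥(maximalRealSubfield L)) L (IsCMField.complexConj L) 2).Adelic]

/-! ## §1 Per-point continued truncated families off ONE countable set, on the package clauses -/

/-- **PER-POINT CONTINUED TRUNCATED `L²`-FAMILIES ON THE PACKAGE CLAUSES** (★ `chiEisenstein_perPoint_family_maximalLevel_cm_two`'s derivation, its first `obtain` turned into binders at the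
singleton basis `{φ}`): there is ONE countable `S ⊇ P` such that for every level `T ≥ 1` and every `z` with `½ < Re z`, `Im z ≠ 0`, `z ∉ S` there are a domain `D₁ ∋ z` in one quadrant
(open, preconnected, two sub-tube boxes, `D₁ ⊆ Pᶜ`) and an `L²(X)`-valued family holomorphic on `D₁` agreeing a.e. with `x ↦ Λ^T E(f_w^φ)(x)` for `1 < Re w` — the band datum being
`w_z = f_z^φ + f_{1−z}^{qc(z)φ}`. [cite: MoeglinWaldspurger1995, IV.2.3] [cite: BernsteinLapid2019, Thm 2.3, §4] -/
theorem perPoint_families_of_package_m1_cm_two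
    (μ : Measure (quasiSplit (↥(maximalRealSubfield L)) L (IsCMField.complexConj L) 2).automorphicQuotient) [(quasiSplit (↥(maximalRealSubfield L)) L (IsCMField.complexConj L) 2).IsAutomorphicMeasure μ]
    (ν : Measure ↥(adelicUnipotent (↥(maximalRealSubfield L)) L (IsCMField.complexConj L) 2)) [ν.IsHaarMeasure]
    {𝓕 : Set ↥(adelicUnipotent (↥(maximalRealSubfield L)) L (IsCMField.complexConj L) 2)}
    (h𝓕N : IsFundamentalDomain ↥(rationalUnipotent (↥(maximalRealSubfield L)) L (IsCMField.complexConj L) 2) 𝓕 ν) (h𝓕c : IsCompact (closure 𝓕))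
    {χ : HeckeCharacter L} {φ : (quasiSplit (↥(maximalRealSubfield L)) L (IsCMField.complexConj L) 2).Adelic → ℂ} (hφ : IsChiSection χ φ) (hφc : Continuous φ) {Mφ : ℝ} (hφM : ∀ x, ‖φ x‖ ≤ Mφ)
    {q qc : Unit → ℂ → ℂ} {Ec : ℂ → (quasiSplit (↥(maximalRealSubfield L)) L (IsCMField.complexConj L) 2).Adelic → ℂ} {P : Set ℂ}
    (hqφ : ∀ z : ℂ, 1 < z.re → (∑ j, q j z • φ) = ((((ν 𝓕).toReal⁻¹ : ℝ)) : ℂ) • (fun g : (quasiSplit (↥(maximalRealSubfield L)) L (IsCMField.complexConj L) 2).Adelic => (∫ v : ↥(adelicUnipotent (↥(maximalRealSubfield L)) L (IsCMField.complexConj L) 2), flatSectionU φ z ((quasiSplit (↥(maximalRealSubfield L)) L (IsCMField.complexConj L) 2).toAdelic (weylLongU ((IsCMField.complexConj L : L ≃ₐ[↥(maximalRealSubfield L)] L) : L →+* L) (rfl : (StdForm.antidiagonal 2).over L = (StdForm.antidiagonal 2).over L)) * ((v : (quasiSplit (↥(maximalRealSubfield L)) L (IsCMField.complexConj L) 2).Adelic)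 * g)) ∂ν) * (((borelHeight g : ℝ) : ℂ) ^ (z - 1))))
    (hE1 : ∀ z : ℂ, 1 < z.re → Ec z = eisensteinSeriesU (flatSectionU φ z)) (hqcq : ∀ j (z : ℂ), 1 < z.re → qc j z = q j z)
    (hPc : IsClosed P) (hPcd : ∀ z₀ : ℂ, ∀ᶠ s in 𝓝[≠] z₀, s ∉ P) (hqa : ∀ j (z : ℂ), z ∉ P → AnalyticAt ℂ (qc j) z)
    (U : ℕ → Set ℂ) (hUo : ∀ n, IsOpen (U n)) (hUcod : ∀ n : ℕ, ∀ z₀ ∈ Metric.ball (0 : ℂ) (n + 2), ∀ᶠ s in 𝓝[≠] z₀, s ∈ U n)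
    (T₀ : ℕ → ℝ≥0) (hT₀ : ∀ n, 1 ≤ T₀ n) (Fam : ℕ → ℂ → Lp ℂ 2 μ) (hFd : ∀ n, DifferentiableOn ℂ (Fam n) (U n \ P))
    (hFam : ∀ n, ∀ z ∈ U n \ P, ((Fam n z : Lp ℂ 2 μ) : (quasiSplit (↥(maximalRealSubfield L)) L (IsCMField.complexConj L) 2).automorphicQuotient → ℂ) =ᵐ[μ] (quasiSplit (↥(maximalRealSubfield L)) L (IsCMField.complexConj L) 2).quotFun (truncation ν 𝓕 (T₀ n) (Ec z))) :
    ∃ S : Set ℂ, S.Countable ∧ P ⊆ S ∧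
      ∀ T : ℝ≥0, 1 ≤ T → ∀ z : ℂ, 1 / 2 < z.re → z.im ≠ 0 → z ∉ S →
        ∃ (D₁ O₁ O₂' : Set ℂ) (Fam' : ℂ → Lp ℂ 2 μ), IsOpen D₁ ∧ IsPreconnected D₁ ∧
          (D₁ ⊆ {z : ℂ | 1 / 2 < z.re ∧ 0 < z.im} ∨ D₁ ⊆ {z : ℂ | 1 / 2 < z.re ∧ z.im < 0}) ∧
          IsOpen O₁ ∧ O₁.Nonempty ∧ O₁ ⊆ D₁ ∧ IsOpen O₂' ∧ O₂'.Nonempty ∧ O₂' ⊆ D₁ ∧ (∀ w ∈ O₁, ∀ w' ∈ O₂', 1 < w'.re ∧ w'.re < w.re) ∧ z ∈ D₁ ∧ D₁ ⊆ Pᶜ ∧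
          DifferentiableOn ℂ Fam' D₁ ∧
          ∀ w' ∈ D₁, 1 < w'.re → ((Fam' w' : Lp ℂ 2 μ) : (quasiSplit (↥(maximalRealSubfield L)) L (IsCMField.complexConj L) 2).automorphicQuotient → ℂ) =ᵐ[μ]
            (quasiSplit (↥(maximalRealSubfield L)) L (IsCMField.complexConj L) 2).quotFun (truncation ν 𝓕 T (Ec w')) := by
  classical
  have hPcount : P.Countable := countable_of_codiscreteWithin fun x _ => hPcd x
  have hqdiff : ∀ j, DifferentiableOn ℂ (qc j) Pᶜ := fun j z hz => (hqa j z hz).differentiableAt.differentiableWithinAt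
  -- the band datum `w_z = f_z^φ + f_{1−z}^{(Σ_j qc_j z)•φ}`
  set w : ℂ → (quasiSplit (↥(maximalRealSubfield L)) L (IsCMField.complexConj L) 2).Adelic → ℂ := fun z => flatSectionU φ z + flatSectionU (∑ j, qc j z • φ) (1 - z) with hw
  have hw_apply : ∀ z g, w z g = φ g * (((borelHeight g : ℝ≥0) : ℝ) : ℂ) ^ z + (∑ j, qc j z * φ g) * (((borelHeight g : ℝ≥0) : ℝ) : ℂ) ^ (1 - z) := fun z g => by
    simp only [hw, Pi.add_apply, flatSectionU_apply, Finset.sum_apply, Pi.smul_apply, smul_eq_mul]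
  -- (B(F)) invariance
  have hwB : ∀ z : ℂ, z ∉ P → ∀ β' ∈ arithmeticBorel (↥(maximalRealSubfield L)) L (IsCMField.complexConj L) 2, ∀ g,
      w z ((β' : (quasiSplit (↥(maximalRealSubfield L)) L (IsCMField.complexConj L) 2).Adelic) * g) = w z g := by
    intro z _ β' hβ' g
    rw [hw_apply, hw_apply, hφ.arithmeticBorel_mul β' hβ' g, K2E1TruncatedEisensteinExplicit.borelHeight_arithmeticBorel_mul hβ']
  -- continuity
  have hwc : ∀ z : ℂ, z ∉ P → Continuous (w z) := by
    intro z _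
    have : w z = fun g => φ g * (((borelHeight g : ℝ≥0) : ℝ) : ℂ) ^ z + (∑ j, qc j z * φ g) * (((borelHeight g : ℝ≥0) : ℝ) : ℂ) ^ (1 - z) := funext fun g => hw_apply z g
    rw [this]
    exact (hφc.mul (continuous_borelHeight_cpow z)).add ((continuous_finsetSum _ fun j _ => continuous_const.mul hφc).mul (continuous_borelHeight_cpow (1 - z)))
  -- pointwise holomorphy off `P`
  have hwd : ∀ g, DifferentiableOn ℂ (fun z => w z g) Pᶜ := by
    intro g
    have hH : (((borelHeight g : ℝ≥0) : ℝ) : ℂ) ≠ 0 := Complex.ofReal_ne_zero.2 (ne_of_gt (borelHeight_coe_pos g))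
    have : (fun z => w z g) = fun z => φ g * (((borelHeight g : ℝ≥0) : ℝ) : ℂ) ^ z + (∑ j, qc j z * φ g) * (((borelHeight g : ℝ≥0) : ℝ) : ℂ) ^ (1 - z) := funext fun z => hw_apply z g
    rw [this]
    refine DifferentiableOn.add ?_ ((DifferentiableOn.fun_sum fun j _ => (hqdiff j).mul_const _).mul ?_)
    · exact fun z _ => ((differentiableAt_id.const_cpow (Or.inl hH)).const_mul _).differentiableWithinAt
    · exact fun z _ => ((differentiableAt_id.const_sub (1 : ℂ)).const_cpow (Or.inl hH)).differentiableWithinAt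
  -- local boundedness on bands above height 1
  have hwloc : ∀ z₀ : ℂ, z₀ ∉ P → ∀ lo hi : ℝ≥0, 1 ≤ lo → ∃ r > 0, Metric.ball z₀ r ⊆ Pᶜ ∧
      ∃ M : ℝ, ∀ z ∈ Metric.ball z₀ r, ∀ g, lo < borelHeight g → borelHeight g ≤ hi → ‖w z g‖ ≤ M := by
    intro z₀ hz₀ lo hi hlo
    obtain ⟨r₀, hr₀, hr₀P⟩ := Metric.isOpen_iff.1 hPc.isOpen_compl z₀ hz₀
    set r : ℝ := r₀ / 2 with hr
    have hr0 : 0 < r := by rw [hr]; positivity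
    have hcl : Metric.closedBall z₀ r ⊆ Pᶜ := (Metric.closedBall_subset_ball (by rw [hr]; linarith)).trans hr₀P
    have hQ : ∀ j, ∃ Q : ℝ, ∀ z ∈ Metric.closedBall z₀ r, ‖qc j z‖ ≤ Q := fun j =>
      (isCompact_closedBall z₀ r).exists_bound_of_continuousOn (((hqdiff j).mono hcl).continuousOn)
    choose Q hQ using hQ
    set R : ℝ := |z₀.re| + r with hR
    refine ⟨r, hr0, (Metric.ball_subset_closedBall).trans hcl, Mφ * (hi : ℝ) ^ R + (∑ j, Q j * Mφ) * (hi : ℝ) ^ (1 + R), fun z hz g h1 h2 => ?_⟩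
    have hM0 : 0 ≤ Mφ := (norm_nonneg _).trans (hφM g)
    have hH1 : (1 : ℝ) ≤ ((borelHeight g : ℝ≥0) : ℝ) := by exact_mod_cast hlo.trans h1.le
    have hHhi : ((borelHeight g : ℝ≥0) : ℝ) ≤ hi := by exact_mod_cast h2
    have hhi1 : (1 : ℝ) ≤ hi := hH1.trans hHhi
    have hzre : |z.re| ≤ R := by
      have h3 : |z.re - z₀.re| ≤ ‖z - z₀‖ := by simpa only [Complex.sub_re] using Complex.abs_re_le_norm (z - z₀)
      have h4 : ‖z - z₀‖ < r := by rwa [Metric.mem_ball, dist_eq_norm] at hz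
      rw [hR]
      have := abs_sub_abs_le_abs_sub z.re z₀.re
      linarith
    have hpow : ‖(((borelHeight g : ℝ≥0) : ℝ) : ℂ) ^ z‖ ≤ (hi : ℝ) ^ R := by
      rw [norm_borelHeight_cpow]
      calc ((borelHeight g : ℝ≥0) : ℝ) ^ z.re ≤ ((borelHeight g : ℝ≥0) : ℝ) ^ |z.re| := Real.rpow_le_rpow_of_exponent_le hH1 (le_abs_self _)
        _ ≤ (hi : ℝ) ^ |z.re| := Real.rpow_le_rpow (by positivity) hHhi (abs_nonneg _)
        _ ≤ (hi : ℝ) ^ R := Real.rpow_le_rpow_of_exponent_le hhi1 hzre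
    have hpow' : ‖(((borelHeight g : ℝ≥0) : ℝ) : ℂ) ^ (1 - z)‖ ≤ (hi : ℝ) ^ (1 + R) := by
      rw [norm_borelHeight_cpow]
      have hre : (1 - z).re ≤ 1 + R := by rw [Complex.sub_re, Complex.one_re]; linarith [neg_abs_le z.re]
      calc ((borelHeight g : ℝ≥0) : ℝ) ^ (1 - z).re ≤ ((borelHeight g : ℝ≥0) : ℝ) ^ (1 + R) := Real.rpow_le_rpow_of_exponent_le hH1 hre
        _ ≤ (hi : ℝ) ^ (1 + R) := Real.rpow_le_rpow (by positivity) hHhi (by positivity)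
    have hzcl : z ∈ Metric.closedBall z₀ r := Metric.ball_subset_closedBall hz
    have hQ0 : ∀ j, 0 ≤ Q j := fun j => (norm_nonneg _).trans (hQ j z₀ (Metric.mem_closedBall_self hr0.le))
    rw [hw_apply]
    refine (norm_add_le _ _).trans (add_le_add ?_ ?_)
    · rw [norm_mul]
      exact mul_le_mul (hφM g) hpow (norm_nonneg _) hM0
    · rw [norm_mul]
      refine mul_le_mul ((norm_sum_le _ _).trans (Finset.sum_le_sum fun j _ => ?_)) hpow' (norm_nonneg _) (Finset.sum_nonneg fun j _ => mul_nonneg (hQ0 j) hM0)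
      rw [norm_mul]
      exact mul_le_mul (hQ j z hzcl) (hφM g) (norm_nonneg _) (hQ0 j)
  -- the tube constant term
  have hCT : ∀ z : ℂ, z ∉ P → 1 < z.re → ∀ g, borelConstantTerm ν 𝓕 (eisensteinSeriesU (flatSectionU φ z)) g = w z g := by
    intro z _ hz g
    have hH : (((borelHeight g : ℝ≥0) : ℝ) : ℂ) ≠ 0 := Complex.ofReal_ne_zero.2 (ne_of_gt (borelHeight_coe_pos g))
    rw [borelConstantTerm_chiEisenstein_cm_two L ν h𝓕N h𝓕c hφ hφc hφM hz g, hw_apply, flatSectionU_apply]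
    congr 1
    have hsum := congrFun (hqφ z hz) g
    simp only [Finset.sum_apply, Pi.smul_apply, smul_eq_mul] at hsum
    rw [show (∑ j, qc j z * φ g) = ∑ j, q j z * φ g from Finset.sum_congr rfl fun j _ => by rw [hqcq j z hz], hsum, Complex.real_smul,
      mul_assoc, mul_assoc, ← Complex.cpow_add _ _ hH, show z - 1 + (1 - z) = 0 by ring, Complex.cpow_zero, mul_one]
    congr 1
    refine integral_congr_ae (Filter.Eventually.of_forall fun v => ?_)
    simp only [mul_assoc]
  -- assemble
  refine ⟨P ∪ ⋃ n : {n : ℕ // 0 ≤ n}, (Metric.ball (0 : ℂ) ((n : ℕ) + 2) \ U n), countable_bad hPcount 0 U (fun n _ => hUcod n), Set.subset_union_left, ?_⟩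
  intro T hT z hz₁ hzim hzS
  obtain ⟨hzP, n, hn₀, hn2, hzn, hzU⟩ := exists_good_ball 0 U hzS
  exact exists_perPoint_truncatedFamily' L μ ν 𝓕 hT φ Ec hE1 hPc hPcount 0 U T₀ Fam (fun n _ => hUo n) (fun n _ => hUcod n) (fun n _ => hT₀ n)
    (fun n _ => hFd n) (fun n _ z hz _ => hFam n z hz) w hwB hwc hwd hwloc hCT hz₁ hzim hzP hn₀ hn2 hzn hzU

/-! ## §2 The χ-Maass–Selberg four-term formula at level `1` for raw tube points, in the rank-one model `V := ℂ` -/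

variable [MeasurableSpace (AdeleRing (𝓞 L) L)ˣ] [BorelSpace (AdeleRing (𝓞 L) L)ˣ]

/-- **THE FOUR-TERM FORMULA IN RANK ONE, ON THE PACKAGE CLAUSES.**  For the M1 datum and its pinned package: `∫_X Λ¹E(f_z^φ)·conj Λ¹E(f_{z′}^φ) dμ` equals the four-term expression of
★ `hB_of_perPoint_families_off_countable`'s letter `h4` with `V := ℂ`, `v := 1`, `M w := qc default w • id`, `κ` the idelic bracket constant and `m := ‖[φ|_K]‖²` — ★ B2 at level `1` on
`D₁ := {1 < Re}` with the `L²`-classes of the truncations and the model section `ψ(w) = qc(w)•[φ|_K]`. [cite: MoeglinWaldspurger1995, IV.2.3] [cite: Arthur1980TraceFormulaII, §4] -/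
theorem fourTerm_rankOne_of_package_m1_cm_two
    (μ : Measure (quasiSplit (↥(maximalRealSubfield L)) L (IsCMField.complexConj L) 2).automorphicQuotient) [(quasiSplit (↥(maximalRealSubfield L)) L (IsCMField.complexConj L) 2).IsAutomorphicMeasure μ]
    (νG : Measure (quasiSplit (↥(maximalRealSubfield L)) L (IsCMField.complexConj L) 2).Adelic) [νG.IsHaarMeasure] [νG.IsInvInvariant]
    (μK : Measure ↥((standardMaximalCompactGL 2 L).comap (adelicVal (↥(maximalRealSubfield L)) L (IsCMField.complexConj L) 2 ((StdForm.antidiagonal 2).over L)) : Subgroup (quasiSplit (↥(maximalRealSubfield L)) L (IsCMField.complexConj L) 2).Adelic)) [μK.IsHaarMeasure]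
    (νI : Measure (AdeleRing (𝓞 L) L)ˣ) [νI.IsHaarMeasure]
    {𝓕I : Set (AdeleRing (𝓞 L) L)ˣ} (h𝓕I : IsIdeleClassDomain L 𝓕I)
    (ν : Measure ↥(adelicUnipotent (↥(maximalRealSubfield L)) L (IsCMField.complexConj L) 2)) [ν.IsHaarMeasure]
    {𝓕 : Set ↥(adelicUnipotent (↥(maximalRealSubfield L)) L (IsCMField.complexConj L) 2)} (h𝓕N : IsFundamentalDomain ↥(rationalUnipotent (↥(maximalRealSubfield L)) L (IsCMField.complexConj L) 2) 𝓕 ν) (h𝓕1 : ν 𝓕 = 1)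
    (h𝓕c : IsCompact (closure 𝓕))
    {β : (quasiSplit (↥(maximalRealSubfield L)) L (IsCMField.complexConj L) 2).Adelic → ℝ≥0∞} (hβ : IsCoveringWeight ↥((arithmeticBorel (↥(maximalRealSubfield L)) L (IsCMField.complexConj L) 2).map (quasiSplit (↥(maximalRealSubfield L)) L (IsCMField.complexConj L) 2).arithmeticSubgroup.subtype) β)
    {χ : HeckeCharacter L} (hχ : χ.IsUnitary) (hρ : ∀ r : ℝ≥0ˣ, χ (posRealIdele L r) = 1) (hsd : reflectChar (IsCMField.complexConj L) χ = χ)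
    {φ : (quasiSplit (↥(maximalRealSubfield L)) L (IsCMField.complexConj L) 2).Adelic → ℂ} (hφV : φ ∈ chiSectionSpace χ ((standardMaximalCompactGL 2 L).comap (adelicVal (↥(maximalRealSubfield L)) L (IsCMField.complexConj L) 2 ((StdForm.antidiagonal 2).over L)) : Subgroup (quasiSplit (↥(maximalRealSubfield L)) L (IsCMField.complexConj L) 2).Adelic) (fun _ => 1)) (hφc : Continuous φ) {Mφ : ℝ} (hφM : ∀ x, ‖φ x‖ ≤ Mφ)
    (hφinf : ∀ a : arch (↥(maximalRealSubfield L)) L (IsCMField.complexConj L) 2 ((StdForm.antidiagonal 2).over L), φ (archToAdelic (↥(maximalRealSubfield L)) L (IsCMField.complexConj L) 2 _ a) = φ 1)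
    {q qc : Unit → ℂ → ℂ}
    (hqφ : ∀ z : ℂ, 1 < z.re → (∑ j, q j z • φ) = ((((ν 𝓕).toReal⁻¹ : ℝ)) : ℂ) • (fun g : (quasiSplit (↥(maximalRealSubfield L)) L (IsCMField.complexConj L) 2).Adelic => (∫ v : ↥(adelicUnipotent (↥(maximalRealSubfield L)) L (IsCMField.complexConj L) 2), flatSectionU φ z ((quasiSplit (↥(maximalRealSubfield L)) L (IsCMField.complexConj L) 2).toAdelic (weylLongU ((IsCMField.complexConj L : L ≃ₐ[↥(maximalRealSubfield L)] L) : L →+* L) (rfl : (StdForm.antidiagonal 2).over L = (StdForm.antidiagonal 2).over L)) * ((v : (quasiSplit (↥(maximalRealSubfield L)) L (IsCMField.complexConj L) 2).Adelic) * g)) ∂ν) * (((borelHeight g : ℝ) : ℂ) ^ (z - 1))))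
    (hqcq : ∀ j (z : ℂ), 1 < z.re → qc j z = q j z)
    (φK : Lp ℂ 2 μK) (hφK : ((φK : Lp ℂ 2 μK) : _ → ℂ) =ᵐ[μK] fun k => φ (k : (quasiSplit (↥(maximalRealSubfield L)) L (IsCMField.complexConj L) 2).Adelic)) :
    ∃ cμ K : ℝ, 0 < cμ ∧ 0 < K ∧ ∀ z z' : ℂ, 1 < z'.re → z'.re < z.re →
      ∫ x, (quasiSplit (↥(maximalRealSubfield L)) L (IsCMField.complexConj L) 2).quotFun (truncation ν 𝓕 1 (eisensteinSeriesU (flatSectionU φ z))) x *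
          conj ((quasiSplit (↥(maximalRealSubfield L)) L (IsCMField.complexConj L) 2).quotFun (truncation ν 𝓕 1 (eisensteinSeriesU (flatSectionU φ z'))) x) ∂μ =
      ((cμ : ℝ) : ℂ) * (((K : ℝ) : ℂ) *
        ((((((1 : ℝ≥0) : ℝ) : ℝ) : ℂ) ^ (z + conj z' - 1) / (z + conj z' - 1)) * ((((∫ x in {x : (AdeleRing (𝓞 L) L)ˣ | (IdeleClassGroup.ideleNorm L x : ℝ) ≤ 1} ∩ 𝓕I, (IdeleClassGroup.ideleNorm L x : ℝ) ∂νI) : ℝ) : ℂ) * (((‖φK‖ ^ 2 : ℝ) : ℂ) * ⟪(fun _ : Unit => (1 : ℂ)) (), (fun _ : Unit => (1 : ℂ)) ()⟫_ℂ))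
          + (((((1 : ℝ≥0) : ℝ) : ℝ) : ℂ) ^ (z - conj z') / (z - conj z')) * ((((∫ x in {x : (AdeleRing (𝓞 L) L)ˣ | (IdeleClassGroup.ideleNorm L x : ℝ) ≤ 1} ∩ 𝓕I, (IdeleClassGroup.ideleNorm L x : ℝ) ∂νI) : ℝ) : ℂ) * (((‖φK‖ ^ 2 : ℝ) : ℂ) * ⟪(fun w : ℂ => qc default w • (LinearMap.id : ℂ →ₗ[ℂ] ℂ)) z' ((fun _ : Unit => (1 : ℂ)) ()), (fun _ : Unit => (1 : ℂ)) ()⟫_ℂ))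
          - (((((1 : ℝ≥0) : ℝ) : ℝ) : ℂ) ^ (-(z - conj z')) / (z - conj z')) * ((((∫ x in {x : (AdeleRing (𝓞 L) L)ˣ | (IdeleClassGroup.ideleNorm L x : ℝ) ≤ 1} ∩ 𝓕I, (IdeleClassGroup.ideleNorm L x : ℝ) ∂νI) : ℝ) : ℂ) * (((‖φK‖ ^ 2 : ℝ) : ℂ) * ⟪(fun _ : Unit => (1 : ℂ)) (), (fun w : ℂ => qc default w • (LinearMap.id : ℂ →ₗ[ℂ] ℂ)) z ((fun _ : Unit => (1 : ℂ)) ())⟫_ℂ))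
          - (((((1 : ℝ≥0) : ℝ) : ℝ) : ℂ) ^ (-(z + conj z' - 1)) / (z + conj z' - 1)) * ((((∫ x in {x : (AdeleRing (𝓞 L) L)ˣ | (IdeleClassGroup.ideleNorm L x : ℝ) ≤ 1} ∩ 𝓕I, (IdeleClassGroup.ideleNorm L x : ℝ) ∂νI) : ℝ) : ℂ) * (((‖φK‖ ^ 2 : ℝ) : ℂ) * ⟪(fun w : ℂ => qc default w • (LinearMap.id : ℂ →ₗ[ℂ] ℂ)) z' ((fun _ : Unit => (1 : ℂ)) ()), (fun w : ℂ => qc default w • (LinearMap.id : ℂ →ₗ[ℂ] ℂ)) z ((fun _ : Unit => (1 : ℂ)) ())⟫_ℂ)))) := by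
  classical
  have h1r : ((((ν 𝓕).toReal⁻¹ : ℝ)) : ℂ) = 1 := by rw [h𝓕1, ENNReal.toReal_one, inv_one, Complex.ofReal_one]
  have hφχ : IsChiSection χ φ := isChiSection_of_mem hφV
  -- the `L²`-classes of the truncations at level 1 on the tube (★ `memLp_quotFun_truncation_…`, with `hdec` ← ★ `hdec_maximalLevel_cm_two`)
  have hdec := hdec_maximalLevel_cm_two L ν h𝓕N h𝓕c hχ hφV hφc hφM hφinf
  have hmem : ∀ z : ℂ, 1 < z.re → MemLp ((quasiSplit (↥(maximalRealSubfield L)) L (IsCMField.complexConj L) 2).quotFun (truncation ν 𝓕 1 (eisensteinSeriesU (flatSectionU φ z)))) 2 μ := by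
    intro z hz
    obtain ⟨M₁, hM₁⟩ := hdec 1 le_rfl z hz
    exact memLp_quotFun_truncation_eisensteinSeriesU_flatSectionU_cm_two L ν h𝓕N le_rfl hz hφc hφM hφχ.toAdelic_mul hM₁ μ 2
  -- the family `F` and its tube identity
  obtain ⟨F, hF⟩ : ∃ F : ℂ → Lp ℂ 2 μ, ∀ z : ℂ, ∀ hz : 1 < z.re, F z = (hmem z hz).toLp _ :=
    ⟨fun z => if hz : 1 < z.re then (hmem z hz).toLp _ else 0, fun z hz => dif_pos hz⟩
  have hFtube : ∀ z ∈ {z : ℂ | 1 < z.re}, 1 < z.re → ((F z : Lp ℂ 2 μ) : (quasiSplit (↥(maximalRealSubfield L)) L (IsCMField.complexConj L) 2).automorphicQuotient → ℂ) =ᵐ[μ]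
      (quasiSplit (↥(maximalRealSubfield L)) L (IsCMField.complexConj L) 2).quotFun (truncation ν 𝓕 1 (eisensteinSeriesU (flatSectionU φ z))) := fun z _ hz => by
    rw [hF z hz]
    exact MemLp.coeFn_toLp _
  -- the model section `ψ(z) = qc(z)•[φ|_K]` and its tube identity
  have hψtube : ∀ z ∈ {z : ℂ | 1 < z.re}, 1 < z.re → (((qc default z • φK : Lp ℂ 2 μK)) : _ → ℂ) =ᵐ[μK] fun k => (fun g : (quasiSplit (↥(maximalRealSubfield L)) L (IsCMField.complexConj L) 2).Adelic => (∫ v : ↥(adelicUnipotent (↥(maximalRealSubfield L)) L (IsCMField.complexConj L) 2), flatSectionU φ z ((quasiSplit (↥(maximalRealSubfield L)) L (IsCMField.complexConj L) 2).toAdelic (weylLongU ((IsCMField.complexConj L : L ≃ₐ[↥(maximalRealSubfield L)] L) : L →+* L) (rfl : (StdForm.antidiagonal 2).over L = (StdForm.antidiagonal 2).over L)) * ((v : (quasiSplit (↥(maximalRealSubfield L)) L (IsCMField.complexConj L) 2).Adelic) * g)) ∂ν) * ((borelHeight g : ℝ) : ℂ) ^ (z - 1)) (k : (quasiSplit (↥(maximalRealSubfield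 L)) L (IsCMField.complexConj L) 2).Adelic) := by
    intro z _ hz
    filter_upwards [Lp.coeFn_smul (qc default z) φK, hφK] with k hk hφk
    rw [hk, Pi.smul_apply, hφk, smul_eq_mul]
    have happ := congrFun (hqφ z hz) (k : (quasiSplit (↥(maximalRealSubfield L)) L (IsCMField.complexConj L) 2).Adelic)
    rw [Finset.sum_apply, Pi.smul_apply, h1r, one_smul] at happ
    simp only [Pi.smul_apply, smul_eq_mul, Fintype.sum_unique] at happ
    rw [← hqcq default z hz] at happ
    exact happ
  -- ★ B2 at level 1 on `D₁ := {1 < Re}`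
  obtain ⟨cμ, K, hcμ, hK, hrel⟩ := inner_truncatedFamily_eq_fourTerm_chi_model_cm_two L μ νG μK νI h𝓕I ν h𝓕N h𝓕1 h𝓕c hβ (le_refl (1 : ℝ≥0)) hχ hρ hφc hφχ hφM hφc hφχ hφM
    (hdec 1 le_rfl) F F hFtube hFtube hsd φK φK hφK hφK (fun z => qc default z • φK) (fun z => qc default z • φK) hψtube hψtube
  refine ⟨cμ, K, hcμ, hK, fun z z' hz' hzz' => ?_⟩
  have hz : 1 < z.re := hz'.trans hzz'
  -- LHS: the `L²` inner product is the raw integral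
  have hL : ⟪F z', F z⟫_ℂ = ∫ x, (quasiSplit (↥(maximalRealSubfield L)) L (IsCMField.complexConj L) 2).quotFun (truncation ν 𝓕 1 (eisensteinSeriesU (flatSectionU φ z))) x *
      conj ((quasiSplit (↥(maximalRealSubfield L)) L (IsCMField.complexConj L) 2).quotFun (truncation ν 𝓕 1 (eisensteinSeriesU (flatSectionU φ z'))) x) ∂μ := by
    rw [MeasureTheory.L2.inner_def]
    refine integral_congr_ae ?_
    filter_upwards [hFtube z hz hz, hFtube z' hz' hz'] with x hx hx'
    rw [RCLike.inner_apply', hx, hx', mul_comm]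
  rw [← hL, hrel z hz z' hz' hz' hzz']
  -- RHS: the rank-one brackets
  have hκφ : ⟪φK, φK⟫_ℂ = (((‖φK‖ ^ 2 : ℝ)) : ℂ) := by
    have h := real_mul_inner_self 1 1 φK
    simp only [one_mul, Complex.ofReal_one] at h
    exact h
  simp only [LinearMap.smul_apply, LinearMap.id_coe, id_eq, inner_smul_left, inner_smul_right, RCLike.inner_apply', map_one, mul_one, one_mul, hκφ]
  push_cast
  ring

/-! ## §3 HEAD: the strip bound on the package clauses -/

/-- **HEAD — THE STRIP BOUND OF THE RANK-ONE SCATTERING SCALAR AT M1, ON THE PINNED PACKAGE'S CLAUSES.**  Binders: ★ p861041's package block (structural data `μ νG μK νI 𝓕I ν 𝓕 β μZ`;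
`χ` self-dual unitary trivial on `ℝ_{>0}`; the normalised M1 section `φ`; the clauses `hqφ hqNF hE1 hqcq hPc hPcd hPre hqa`, the skolemised families, `hs_tube`) and `σ₀ > 1`.  THEN
`∃ B, ∀ z, ½ < Re z → Re z ≤ σ₀ → 1 ≤ |Im z| → ‖qc default z‖ ≤ B` — ★ `hB_of_perPoint_families_off_countable` at `V := ℂ`, `v := 1`, `M w := qc default w • id`, level `1`, with §1's
per-point families, §2's four-term formula, holomorphy off `P` from `hqa`, and continuity on the half-strip from the (d)-realness `hreal` of ★ `chi_scattering_hs_of_scalarPackage_m1_cm_two`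
(sockets `hdec` ★, (FE) ★). [cite: MoeglinWaldspurger1995, IV.2.3, IV.3.12 (a)] [cite: Arthur1980TraceFormulaII, §4] -/
theorem hB_of_package_m1_cm_two
    (μ : Measure (quasiSplit (↥(maximalRealSubfield L)) L (IsCMField.complexConj L) 2).automorphicQuotient) [(quasiSplit (↥(maximalRealSubfield L)) L (IsCMField.complexConj L) 2).IsAutomorphicMeasure μ]
    (νG : Measure (quasiSplit (↥(maximalRealSubfield L)) L (IsCMField.complexConj L) 2).Adelic) [νG.IsHaarMeasure] [νG.IsInvInvariant] [SFinite νG]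
    (μK : Measure ↥((standardMaximalCompactGL 2 L).comap (adelicVal (↥(maximalRealSubfield L)) L (IsCMField.complexConj L) 2 ((StdForm.antidiagonal 2).over L)) : Subgroup (quasiSplit (↥(maximalRealSubfield L)) L (IsCMField.complexConj L) 2).Adelic)) [μK.IsHaarMeasure]
    (νI : Measure (AdeleRing (𝓞 L) L)ˣ) [νI.IsHaarMeasure]
    {𝓕I : Set (AdeleRing (𝓞 L) L)ˣ} (h𝓕I : IsIdeleClassDomain L 𝓕I)
    (ν : Measure ↥(adelicUnipotent (↥(maximalRealSubfield L)) L (IsCMField.complexConj L) 2)) [ν.IsHaarMeasure] [ν.IsMulRightInvariant] [ν.IsInvInvariant]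
    {𝓕 : Set ↥(adelicUnipotent (↥(maximalRealSubfield L)) L (IsCMField.complexConj L) 2)} (h𝓕N : IsFundamentalDomain ↥(rationalUnipotent (↥(maximalRealSubfield L)) L (IsCMField.complexConj L) 2) 𝓕 ν) (h𝓕1 : ν 𝓕 = 1)
    (h𝓕c : IsCompact (closure 𝓕))
    {β : (quasiSplit (↥(maximalRealSubfield L)) L (IsCMField.complexConj L) 2).Adelic → ℝ≥0∞} (hβ : IsCoveringWeight ↥((arithmeticBorel (↥(maximalRealSubfield L)) L (IsCMField.complexConj L) 2).map (quasiSplit (↥(maximalRealSubfield L)) L (IsCMField.complexConj L) 2).arithmeticSubgroup.subtype) β)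
    {μZ : Measure (borelQuotient (↥(maximalRealSubfield L)) L (IsCMField.complexConj L) 2)} [SFinite μZ]
    (hμZ : ∀ f : borelQuotient (↥(maximalRealSubfield L)) L (IsCMField.complexConj L) 2 → ℝ≥0∞, Measurable f → ∫⁻ z, f z ∂μZ = ∫⁻ g, β g * f (toBorelQuotient (↥(maximalRealSubfield L)) L (IsCMField.complexConj L) 2 g) ∂νG)
    {χ : HeckeCharacter L} (hχ : χ.IsUnitary) (hρ : ∀ r : ℝ≥0ˣ, χ (posRealIdele L r) = 1) (hsd : reflectChar (IsCMField.complexConj L) χ = χ)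
    {φ : (quasiSplit (↥(maximalRealSubfield L)) L (IsCMField.complexConj L) 2).Adelic → ℂ} (hφV : φ ∈ chiSectionSpace χ ((standardMaximalCompactGL 2 L).comap (adelicVal (↥(maximalRealSubfield L)) L (IsCMField.complexConj L) 2 ((StdForm.antidiagonal 2).over L)) : Subgroup (quasiSplit (↥(maximalRealSubfield L)) L (IsCMField.complexConj L) 2).Adelic) (fun _ => 1)) (hφc : Continuous φ) {Mφ : ℝ} (hφM : ∀ x, ‖φ x‖ ≤ Mφ)
    (hφinf : ∀ a : arch (↥(maximalRealSubfield L)) L (IsCMField.complexConj L) 2 ((StdForm.antidiagonal 2).over L), φ (archToAdelic (↥(maximalRealSubfield L)) L (IsCMField.complexConj L) 2 _ a) = φ 1)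
    (hφ1 : φ 1 ≠ 0) (hφ1r : conj (φ 1) = φ 1)
    {q qc : Unit → ℂ → ℂ} {Ec : ℂ → (quasiSplit (↥(maximalRealSubfield L)) L (IsCMField.complexConj L) 2).Adelic → ℂ} {P : Set ℂ}
    (hqφ : ∀ z : ℂ, 1 < z.re → (∑ j, q j z • φ) = ((((ν 𝓕).toReal⁻¹ : ℝ)) : ℂ) • (fun g : (quasiSplit (↥(maximalRealSubfield L)) L (IsCMField.complexConj L) 2).Adelic => (∫ v : ↥(adelicUnipotent (↥(maximalRealSubfield L)) L (IsCMField.complexConj L) 2), flatSectionU φ z ((quasiSplit (↥(maximalRealSubfield L)) L (IsCMField.complexConj L) 2).toAdelic (weylLongU ((IsCMField.complexConj L : L ≃ₐ[↥(maximalRealSubfield L)] L) : L →+* L) (rfl : (StdForm.antidiagonal 2).over L = (StdForm.antidiagonal 2).over L)) * ((v : (quasiSplit (↥(maximalRealSubfield L)) L (IsCMField.complexConj L) 2).Adelic) * g)) ∂ν) * (((borelHeight g : ℝ) : ℂ) ^ (z - 1))))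
    (hqNF : ∀ j, MeromorphicNFOn (qc j) univ) (hE1 : ∀ z : ℂ, 1 < z.re → Ec z = eisensteinSeriesU (flatSectionU φ z)) (hqcq : ∀ j (z : ℂ), 1 < z.re → qc j z = q j z)
    (hPc : IsClosed P) (hPcd : ∀ z₀ : ℂ, ∀ᶠ s in 𝓝[≠] z₀, s ∉ P) (hPre : ∀ z ∈ P, z.re ≤ 1) (hqa : ∀ j (z : ℂ), z ∉ P → AnalyticAt ℂ (qc j) z)
    (U : ℕ → Set ℂ) (hUo : ∀ n, IsOpen (U n)) (hUcod : ∀ n : ℕ, ∀ z₀ ∈ Metric.ball (0 : ℂ) (n + 2), ∀ᶠ s in 𝓝[≠] z₀, s ∈ U n)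
    (T₀ : ℕ → ℝ≥0) (hT₀ : ∀ n, 1 ≤ T₀ n) (Fam : ℕ → ℂ → Lp ℂ 2 μ) (hFd : ∀ n, DifferentiableOn ℂ (Fam n) (U n \ P))
    (hFam : ∀ n, ∀ z ∈ U n \ P, ((Fam n z : Lp ℂ 2 μ) : (quasiSplit (↥(maximalRealSubfield L)) L (IsCMField.complexConj L) 2).automorphicQuotient → ℂ) =ᵐ[μ] (quasiSplit (↥(maximalRealSubfield L)) L (IsCMField.complexConj L) 2).quotFun (truncation ν 𝓕 (T₀ n) (Ec z)))
    (hs_tube : ∀ z : ℂ, 1 < z.re → qc default z = (((ν 𝓕).toReal⁻¹ : ℝ) : ℂ) * ((φ 1)⁻¹ * ∫ v : ↥(adelicUnipotent (↥(maximalRealSubfield L)) L (IsCMField.complexConj L) 2), flatSectionU φ z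
        ((quasiSplit (↥(maximalRealSubfield L)) L (IsCMField.complexConj L) 2).toAdelic (weylLongU (IsCMField.complexConj L : L →+* L)
          (rfl : (StdForm.antidiagonal 2).over L = (StdForm.antidiagonal 2).over L)) * ((v : (quasiSplit (↥(maximalRealSubfield L)) L (IsCMField.complexConj L) 2).Adelic) * 1)) ∂ν))
    {σ₀ : ℝ} (hσ₀ : 1 < σ₀) :
    ∃ B : ℝ, ∀ z : ℂ, 1 / 2 < z.re → z.re ≤ σ₀ → 1 ≤ |z.im| → ‖qc default z‖ ≤ B := by
  classical
  have hφ0 : φ ≠ 0 := fun h => hφ1 (by rw [h, Pi.zero_apply])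
  have h𝓕₀ : ν 𝓕 ≠ 0 := by rw [h𝓕1]; exact one_ne_zero
  have hφχ : IsChiSection χ φ := isChiSection_of_mem hφV
  -- (d)-realness on THESE clauses (★ LetterFree §1 with ★ hdec and ★ (FE)): non-real points of the closed half-strip are analytic points
  have hdec := hdec_maximalLevel_cm_two L ν h𝓕N h𝓕c hχ hφV hφc hφM hφinf
  have hFE : ∀ z : ℂ, z ∉ P → 1 - z ∉ P → qc default z * qc default (1 - z) = 1 :=
    chi_scattering_fe_m1_cm_two L μ νG ν h𝓕N h𝓕c h𝓕₀ hβ hμZ hsd hφV hφc hφM hφinf hφ0 hqφ hqcq hPc hPcd hPre hqa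
  have hreal := (chi_scattering_hs_of_scalarPackage_m1_cm_two L μ νG μK νI h𝓕I ν h𝓕N h𝓕1 h𝓕c hβ hχ hρ hsd hφV hφc hφM hφ1 hφ1r hqφ hqNF hE1 hqcq hPc hPcd hPre hqa U hUo hUcod
    T₀ hT₀ Fam hFd hFam hs_tube hdec hFE hσ₀).1
  -- the `L²(K_max)`-class of `φ|_{K_max}` (non-zero) and the idelic bracket constant
  haveI : CompactSpace ↥((standardMaximalCompactGL 2 L).comap (adelicVal (↥(maximalRealSubfield L)) L (IsCMField.complexConj L) 2 ((StdForm.antidiagonal 2).over L)) : Subgroup (quasiSplit (↥(maximalRealSubfield L)) L (IsCMField.complexConj L) 2).Adelic) :=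
    isCompact_iff_compactSpace.1 isCompact_comap_adelicVal_standardMaximalCompactGL
  haveI : IsFiniteMeasure μK := CompactSpace.isFiniteMeasure
  have hφKm : MemLp (fun k : ↥((standardMaximalCompactGL 2 L).comap (adelicVal (↥(maximalRealSubfield L)) L (IsCMField.complexConj L) 2 ((StdForm.antidiagonal 2).over L)) : Subgroup (quasiSplit (↥(maximalRealSubfield L)) L (IsCMField.complexConj L) 2).Adelic) => φ (k : (quasiSplit (↥(maximalRealSubfield L)) L (IsCMField.complexConj L) 2).Adelic)) 2 μK :=
    MemLp.of_bound (hφc.comp continuous_subtype_val).aestronglyMeasurable Mφ (Eventually.of_forall fun k => hφM _)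
  have hφKae : (((hφKm.toLp _ : Lp ℂ 2 μK)) : _ → ℂ) =ᵐ[μK] fun k => φ (k : (quasiSplit (↥(maximalRealSubfield L)) L (IsCMField.complexConj L) 2).Adelic) := MemLp.coeFn_toLp _
  have hφK0 : (hφKm.toLp _ : Lp ℂ 2 μK) ≠ 0 := ne_zero_of_coeFn_ae_eq L μK hφV hφ0 _ hφKae
  have hm : 0 < ‖(hφKm.toLp _ : Lp ℂ 2 μK)‖ ^ 2 := pow_pos (norm_pos_iff.2 hφK0) 2
  have hκ := idelicBracket_pos νI h𝓕I
  -- §1: the per-point families off one countable set; §2: the four-term formula at level 1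
  obtain ⟨S, hSc, -, hpt⟩ := perPoint_families_of_package_m1_cm_two L μ ν h𝓕N h𝓕c hφχ hφc hφM hqφ hE1 hqcq hPc hPcd hqa U hUo hUcod T₀ hT₀ Fam hFd hFam
  obtain ⟨cμ, K, hcμ, hK, h4⟩ := fourTerm_rankOne_of_package_m1_cm_two L μ νG μK νI h𝓕I ν h𝓕N h𝓕1 h𝓕c hβ hχ hρ hsd hφV hφc hφM hφinf hqφ hqcq (hφKm.toLp _) hφKae
  -- ★ p860833 §1 at `V := ℂ`, `v := 1`, `M w := qc default w • id`
  obtain ⟨B, hB⟩ := hB_of_perPoint_families_off_countable L μ ν 𝓕 (le_refl (1 : ℝ≥0)) hcμ hK hκ hm σ₀ hSc (fun _ : Unit => (1 : ℂ)) (fun _ => one_ne_zero) (fun _ : Unit => (1 : ℂ))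
    (fun w : ℂ => qc default w • (LinearMap.id : ℂ →ₗ[ℂ] ℂ))
    (fun _ => by
      simp only [LinearMap.smul_apply, LinearMap.id_coe, id_eq]
      exact (show DifferentiableOn ℂ (qc default) Pᶜ from fun w hw => (hqa default w hw).differentiableAt.differentiableWithinAt).smul_const _)
    (fun _ _ z hz₁ hz₂ ht => by
      have han : AnalyticAt ℂ (qc default) z := by
        by_contra h
        have him := (hreal z h hz₁ hz₂).1
        rw [him, abs_zero] at ht
        exact absurd ht (by norm_num)
      simp only [LinearMap.smul_apply, LinearMap.id_coe, id_eq]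
      exact (continuousAt_const.inner (han.continuousAt.smul continuousAt_const)).continuousWithinAt)
    (fun _ => φ) (fun _ => Ec) (fun _ => hE1) (fun _ => h4) (fun _ z hz₁ hzim hzS => hpt 1 le_rfl z hz₁ hzim hzS)
  refine ⟨B, fun z hz₁ hz₂ ht => ?_⟩
  have h := hB () () z hz₁ hz₂ ht
  simpa only [LinearMap.smul_apply, LinearMap.id_coe, id_eq, smul_eq_mul, inner_smul_right, RCLike.inner_apply', map_one, mul_one, one_mul] using h

end Summit.HodgeConjecture.HodgeConjecture.Cruxes.H413.K2E1ChiScatteringStripBoundOfPackageM1CMTwo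

end
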